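import Summits.QuantumFields.YangMills.Theorems.UnitScaleTiltFluctuationComparisonRegPrLiftFaceLoops
import Summits.QuantumFields.YangMills.Theorems.UnitScaleTiltAvgActionDefectFirstOrder
import Summits.QuantumFields.YangMills.Theorems.UnitScaleTiltFluctuationComparisonRegPrLiftSecondOrder
import Summits.QuantumFields.YangMills.Theorems.UnitScaleTiltFluctuationComparisonRegPrApproxLift

/-!
# Route `UnitScaleTilt` — crux K1bR-pr `FluctuationComparisonRegPr` (stmt-QuantumFields-19201), stub `stub_oneStepSmallLift`
# (W7 line), piece (L2), layers F2–F3: THE (0.4) BLOCK AVERAGE OF A FACE-SUPPORTED CORRECTED SECTION `U⋆ = E · faceSec V` TO SECOND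
# ORDER, and the plaquettes of `E · W` with the first-order term isolated (support file `--supports stmt-QuantumFields-19201`)

Fleet seat `ym-ust-19201-p1` gen 2 (lead of the `[M]` stub; CARD-19201-oneStepSmallLift-L1L2 §2–§3, face-supported base).  Layer F1
(`…LiftFaceLoops`, p470218) made the loop variables and the straight transporter of `U⋆ = E · faceSec V` explicit for an exit-supported
correction `E`: `W_c(r,σ,σ′) = E(exitBond c r) · E(exitBond c r₀)⁻¹`, `U⋆(c) = E(exitBond c r₀) · V(c)`.  Consequences:

* §1 (F2) **`norm_avgFun_mulField_faceSec_sub_le`** (`SU(N)`, printed `exp[mean log]`): for `dist1 (E b) ≤ t ≤ 1/20`, `2t < δ_N`,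
  `‖Ū⋆(c) − V(c)‖ ≤ ‖L^{-d} Σ_r (E(exitBond c r) − 1)‖ + 28 t²` — the first-order term is the FACE MEAN of the correction (p1 g8's
  `coe_corr_eq_eml` + `norm_eml_sub_one_sub_mean_le`); hence **`…_of_faceSum_eq_zero`**: an S-NEUTRAL exponential correction
  (`E = exp ζ` on the face, `Σ_r ζ(exitBond c r) = 0`, `‖ζ‖ ≤ s ≤ 1`) averages back to `V` within `s² + 28t²`, with NO gauge correction;
  `mdist_avgFun_mulField_faceSec_le` is the `SU(2)`/`mdist` form matching `ApproxLift.ApproxLiftStep`'s accuracy clause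
  (`one_tenth_lt_deltaSU_two`).
* §2 (F3) **`dist1_plaqHol_mulField_le_lin_add`** (`SU(N)`, any `W`): with `ρ = 6t² + 4t³ + t⁴`, `D = W(∂p) − 1`,
  `dist1((E·W)(∂p)) ≤ ‖linCobd E W p + D‖ + ρ + (4t + 2ρ)‖D‖` (p2 g8's `norm_twistedCobd_sub_one_sub_lin_le`) — the isolated linear term
  `linCobd + D` is what the certified row bounds of the linear lift (`CertL3Face.rows_all_le`, `CertL5`) control.

What remains for `ApproxSmallLift` (layers F4–F7 of the seat's plan): the kernel datum in tree coordinates, `ζ_V := Σ kz • Ad_τ log V(∂q)`,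
the expansion of `linCobd (exp ζ_V) (faceSec V) p + D` into the kernel row modulo `O(δ²)` (transport discrepancies by `LatticeWordStokes`,
non-abelian Bianchi for `d₂`), and the assembly.  Elementary; nothing of Bałaban's is asserted.
-/

noncomputable section

open scoped BigOperators

namespace Summit.QuantumFields.YangMills.Theorems.ApproxLift

open Literature.MathematicalPhysics.QuantumFieldTheory.Balaban1983to89
open T4Continuum BlockAveraging AveragingRT B10Eq47AxialChi BlockAveragingSection BlockAveragingSectionPlaq

variable {P : Params} {j : ℕ}

/-! ## §1 (layer F2) The block average of a face-supported corrected section to second order -/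

section Avg

open NormedSpace ExpMeanLog
open scoped Matrix.Norms.L2Operator
open Summit.QuantumFields.YangMills.Theorems.AvgActionDefect (coe_corr_eq_eml norm_eml_sub_one_sub_mean_le)

variable {n : Type*} [Fintype n] [DecidableEq n] [Nonempty n]

/-- In the model, `dist1 g = ‖g − 1‖` (operator norm). -/
private theorem dist1_su_eq' (g : Matrix.specialUnitaryGroup n ℂ) : dist1 g = ‖(g : Matrix n n ℂ) - 1‖ := rfl

/-- A special unitary matrix has operator norm `≤ 1`. -/
private theorem norm_coe_su_le_one' (g : Matrix.specialUnitaryGroup n ℂ) : ‖(g : Matrix n n ℂ)‖ ≤ 1 :=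
  (UnitaryModel.norm_of_mem_unitaryGroup (Matrix.specialUnitaryGroup_le_unitaryGroup g.2)).le

omit [Nonempty n] in
/-- `↑g⁻¹ * ↑g = 1` in the matrix model. -/
private theorem coe_inv_mul_coe' (g : Matrix.specialUnitaryGroup n ℂ) :
    ((g⁻¹ : Matrix.specialUnitaryGroup n ℂ) : Matrix n n ℂ) * (g : Matrix n n ℂ) = 1 := by
  rw [← Submonoid.coe_mul, inv_mul_cancel]; rfl

/-- **THE (0.4) BLOCK AVERAGE OF A FACE-SUPPORTED CORRECTED SECTION TO SECOND ORDER** (`SU(N)`, printed `exp[mean log]`): if `E` is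
exit-supported with every `dist1 (E b) ≤ t`, `t ≤ 1/20`, `2t < δ_N`, then for every coarse bond `c`
`‖Ū⋆(c) − V(c)‖ ≤ ‖L^{-d} Σ_r (E(exitBond c r) − 1)‖ + 28 t²`, `U⋆ = E · faceSec V`: the first-order term is the FACE MEAN of the
correction (each exit bond of the face counted `L` times among the `L^d` offsets), so an S-NEUTRAL correction (`Σ_r ζ(exitBond c r) = 0`)
averages back to `V` up to `O(t²)` — with NO gauge correction (standing range). -/
theorem norm_avgFun_mulField_faceSec_sub_le (hj : j + 1 ≤ P.m + P.K) {E : GaugeField P j (Matrix.specialUnitaryGroup n ℂ)}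
    (hE : ExitSupported E) {t : ℝ} (ht : ∀ b, dist1 (E b) ≤ t) (ht' : t ≤ 1 / 20) (hδ : 2 * t < deltaSU n)
    (V : GaugeField P (j + 1) (Matrix.specialUnitaryGroup n ℂ)) (c : PBond P (j + 1)) :
    ‖((avgFun (expMeanLogSU (n := n)) (mulField E (faceSec V)) c : Matrix.specialUnitaryGroup n ℂ) : Matrix n n ℂ) -
        (V c : Matrix n n ℂ)‖ ≤
      ‖(((P.L : ℂ) ^ P.d))⁻¹ • ∑ r : Fin P.d → Fin P.L, (((E (exitBond c r) : Matrix.specialUnitaryGroup n ℂ) : Matrix n n ℂ) - 1)‖ +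
        28 * t ^ 2 := by
  set U : GaugeField P j (Matrix.specialUnitaryGroup n ℂ) := mulField E (faceSec V) with hU
  set E₀ : Matrix.specialUnitaryGroup n ℂ := E (exitBond c (ctr P)) with hE₀
  have t0 : 0 ≤ t := (GaugeGroup.dist1_nonneg _).trans (ht (exitBond c (ctr P)))
  -- the loop variables `W_i = E(b_i) E₀⁻¹` and their size
  have hW : ∀ i : Idx P, loopHol U c i = E (exitBond c i.1) * E₀⁻¹ := fun i => by
    obtain ⟨r, σ, σ'⟩ := i
    exact loopHol_mulField_faceSec hj hE V c r σ σ'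
  have hWd : ∀ i : Idx P, dist1 (loopHol U c i) ≤ 2 * t := fun i => by
    rw [hW i]
    calc dist1 (E (exitBond c i.1) * E₀⁻¹) ≤ dist1 (E (exitBond c i.1)) + dist1 E₀⁻¹ := GaugeGroup.dist1_mul_le _ _
      _ ≤ t + t := by rw [GaugeGroup.dist1_inv]; exact add_le_add (ht _) (ht _)
      _ = 2 * t := by ring
  -- the correction factor is `eml` of the loop family, to second order
  have hcorr := coe_corr_eq_eml (n := n) (U := U) (c := c) fun i => (hWd i).trans_lt hδ
  have hW' : ∀ i : Idx P, ‖((loopHol U c i : Matrix.specialUnitaryGroup n ℂ) : Matrix n n ℂ) - 1‖ ≤ 2 * t := fun i => by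
    rw [← dist1_su_eq']; exact hWd i
  have heml := norm_eml_sub_one_sub_mean_le hW' (by linarith)
  -- the mean deviation: `mean_i (W_i − 1) = m · E₀⁻¹ + (E₀⁻¹ − 1)`
  set m : Matrix n n ℂ := (((P.L : ℂ) ^ P.d))⁻¹ •
    ∑ r : Fin P.d → Fin P.L, (((E (exitBond c r) : Matrix.specialUnitaryGroup n ℂ) : Matrix n n ℂ) - 1) with hm
  have hmean : ((Fintype.card (Idx P) : ℂ))⁻¹ •
      ∑ i : Idx P, (((loopHol U c i : Matrix.specialUnitaryGroup n ℂ) : Matrix n n ℂ) - 1) =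
      m * ((E₀⁻¹ : Matrix.specialUnitaryGroup n ℂ) : Matrix n n ℂ) + (((E₀⁻¹ : Matrix.specialUnitaryGroup n ℂ) : Matrix n n ℂ) - 1) := by
    have hterm : ∀ i : Idx P, (((loopHol U c i : Matrix.specialUnitaryGroup n ℂ) : Matrix n n ℂ) - 1) =
        ((((E (exitBond c i.1) : Matrix.specialUnitaryGroup n ℂ) : Matrix n n ℂ) - 1) *
          ((E₀⁻¹ : Matrix.specialUnitaryGroup n ℂ) : Matrix n n ℂ) +
        (((E₀⁻¹ : Matrix.specialUnitaryGroup n ℂ) : Matrix n n ℂ) - 1)) := fun i => by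
      rw [hW i, Submonoid.coe_mul]; noncomm_ring
    simp_rw [hterm]
    rw [Finset.sum_add_distrib, smul_add, ← Finset.sum_mul, ← smul_mul_assoc,
      mean_idx_eq_mean_offsets (fun r => (((E (exitBond c r) : Matrix.specialUnitaryGroup n ℂ) : Matrix n n ℂ) - 1)),
      Finset.sum_const, Finset.card_univ, ← Nat.cast_smul_eq_nsmul ℂ, smul_smul,
      inv_mul_cancel₀ (by exact_mod_cast Fintype.card_ne_zero), one_smul]
  -- the averaged bond: `Ū(c) = corr · E₀ · V(c)`
  have havg : ((avgFun (expMeanLogSU (n := n)) U c : Matrix.specialUnitaryGroup n ℂ) : Matrix n n ℂ) =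
      ((corr (expMeanLogSU (n := n)) U c : Matrix.specialUnitaryGroup n ℂ) : Matrix n n ℂ) * (E₀ : Matrix n n ℂ) *
        (V c : Matrix n n ℂ) := by
    show (((corr (expMeanLogSU (n := n)) U c * axialAvg U c : Matrix.specialUnitaryGroup n ℂ)) : Matrix n n ℂ) = _
    rw [axialAvg_mulField_faceSec hj hE V c, Submonoid.coe_mul, Submonoid.coe_mul, mul_assoc]
  set C : Matrix n n ℂ := ((corr (expMeanLogSU (n := n)) U c : Matrix.specialUnitaryGroup n ℂ) : Matrix n n ℂ) with hC
  set R : Matrix n n ℂ := C - 1 - ((Fintype.card (Idx P) : ℂ))⁻¹ •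
      ∑ i : Idx P, (((loopHol U c i : Matrix.specialUnitaryGroup n ℂ) : Matrix n n ℂ) - 1) with hR
  have hRle : ‖R‖ ≤ 28 * t ^ 2 := by
    rw [hR, hcorr]
    calc _ ≤ 7 * (2 * t) ^ 2 := heml
      _ = 28 * t ^ 2 := by ring
  have hkey : C * (E₀ : Matrix n n ℂ) - 1 = R * (E₀ : Matrix n n ℂ) + m := by
    have h1 : C = R + 1 + (m * ((E₀⁻¹ : Matrix.specialUnitaryGroup n ℂ) : Matrix n n ℂ) +
        (((E₀⁻¹ : Matrix.specialUnitaryGroup n ℂ) : Matrix n n ℂ) - 1)) := by rw [hR, hmean]; abel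
    rw [h1]
    have h2 := coe_inv_mul_coe' E₀
    noncomm_ring [h2]
  have hsplit : C * (E₀ : Matrix n n ℂ) * (V c : Matrix n n ℂ) - (V c : Matrix n n ℂ) =
      (R * (E₀ : Matrix n n ℂ) + m) * (V c : Matrix n n ℂ) := by rw [← hkey]; noncomm_ring
  rw [havg, hsplit]
  calc ‖(R * (E₀ : Matrix n n ℂ) + m) * (V c : Matrix n n ℂ)‖ ≤ ‖R * (E₀ : Matrix n n ℂ) + m‖ * ‖(V c : Matrix n n ℂ)‖ :=
        norm_mul_le _ _
    _ ≤ ‖R * (E₀ : Matrix n n ℂ) + m‖ * 1 :=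
        mul_le_mul_of_nonneg_left (norm_coe_su_le_one' _) (norm_nonneg _)
    _ ≤ ‖R‖ * ‖(E₀ : Matrix n n ℂ)‖ + ‖m‖ := by rw [mul_one]; exact (norm_add_le _ _).trans (by gcongr; exact norm_mul_le _ _)
    _ ≤ 28 * t ^ 2 * 1 + ‖m‖ := by gcongr; exact norm_coe_su_le_one' _
    _ = ‖m‖ + 28 * t ^ 2 := by ring



/-- **S-NEUTRAL EXPONENTIAL CORRECTIONS AVERAGE BACK TO `V` TO SECOND ORDER**: if moreover `E(b) = exp ζ(b)` on the exit bonds of the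
face of `c` with `‖ζ(b)‖ ≤ s ≤ 1` and the FACE SUM `Σ_r ζ(exitBond c r)` vanishes (the certified identity `S ∘ Z′ = 0`), then
`‖Ū⋆(c) − V(c)‖ ≤ s² + 28 t²`. -/
theorem norm_avgFun_mulField_faceSec_sub_le_of_faceSum_eq_zero (hj : j + 1 ≤ P.m + P.K)
    {E : GaugeField P j (Matrix.specialUnitaryGroup n ℂ)} (hE : ExitSupported E) {t : ℝ} (ht : ∀ b, dist1 (E b) ≤ t)
    (ht' : t ≤ 1 / 20) (hδ : 2 * t < deltaSU n) (V : GaugeField P (j + 1) (Matrix.specialUnitaryGroup n ℂ)) (c : PBond P (j + 1))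
    (ζ : (Fin P.d → Fin P.L) → Matrix n n ℂ) {s : ℝ} (hζE : ∀ r, ((E (exitBond c r) : Matrix.specialUnitaryGroup n ℂ) : Matrix n n ℂ) = exp (ζ r))
    (hζ : ∀ r, ‖ζ r‖ ≤ s) (hs : s ≤ 1) (hsum : ∑ r : Fin P.d → Fin P.L, ζ r = 0) :
    ‖((avgFun (expMeanLogSU (n := n)) (mulField E (faceSec V)) c : Matrix.specialUnitaryGroup n ℂ) : Matrix n n ℂ) -
        (V c : Matrix n n ℂ)‖ ≤ s ^ 2 + 28 * t ^ 2 := by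
  refine (norm_avgFun_mulField_faceSec_sub_le hj hE ht ht' hδ V c).trans (add_le_add ?_ le_rfl)
  have s0 : 0 ≤ s := (norm_nonneg _).trans (hζ (ctr P))
  have hrw : ∑ r : Fin P.d → Fin P.L, (((E (exitBond c r) : Matrix.specialUnitaryGroup n ℂ) : Matrix n n ℂ) - 1) =
      ∑ r : Fin P.d → Fin P.L, (exp (ζ r) - 1 - ζ r) := by
    rw [← sub_zero (∑ r : Fin P.d → Fin P.L, (((E (exitBond c r) : Matrix.specialUnitaryGroup n ℂ) : Matrix n n ℂ) - 1)), ← hsum,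
      ← Finset.sum_sub_distrib]
    exact Finset.sum_congr rfl fun r _ => by rw [hζE r]
  rw [hrw]
  have hcard : (Fintype.card (Fin P.d → Fin P.L) : ℂ) = (P.L : ℂ) ^ P.d := by
    rw [Fintype.card_fun, Fintype.card_fin, Fintype.card_fin, Nat.cast_pow]
  rw [← hcard]
  letI : NormedAlgebra ℝ (Matrix n n ℂ) := NormedAlgebra.restrictScalars ℝ ℂ (Matrix n n ℂ)
  refine AvgActionDefect.norm_mean_le (fun r => ?_) (by positivity)
  calc ‖exp (ζ r) - 1 - ζ r‖ ≤ ‖ζ r‖ ^ 2 :=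
        Literature.MathematicalPhysics.QuantumFieldTheory.OneLinkLaplace.norm_exp_sub_one_sub_le_sq ((hζ r).trans hs)
    _ ≤ s ^ 2 := by gcongr; exact hζ r

/-- `1/10 < δ_{SU(2)} = min (1/3, π/2)`. -/
theorem one_tenth_lt_deltaSU_two : (1 : ℝ) / 10 < deltaSU (Fin 2) := by
  unfold deltaSU
  rw [Fintype.card_fin]
  refine lt_min (by norm_num) ?_
  have := Real.pi_gt_three
  push_cast
  linarith

/-- **THE ACCURACY CLAUSE OF `ApproxLiftStep` FOR `SU(2)`** (`mdist` form, tree `ℰp = expMeanLogSU`): for an exit-supported `E` with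
`dist1 (E b) ≤ t ≤ 1/20`, `mdist (V c) (Ū⋆(c)) ≤ ‖L^{-d} Σ_r (E(exitBond c r) − 1)‖ + 28 t²`. -/
theorem mdist_avgFun_mulField_faceSec_le (hj : j + 1 ≤ P.m + P.K)
    {E : GaugeField P j (Matrix.specialUnitaryGroup (Fin 2) ℂ)} (hE : ExitSupported E) {t : ℝ} (ht : ∀ b, dist1 (E b) ≤ t)
    (ht' : t ≤ 1 / 20) (V : GaugeField P (j + 1) (Matrix.specialUnitaryGroup (Fin 2) ℂ)) (c : PBond P (j + 1)) :
    MiddleBondRepair.mdist (V c) (avgFun (expMeanLogSU (n := Fin 2)) (mulField E (faceSec V)) c) ≤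
      ‖(((P.L : ℂ) ^ P.d))⁻¹ • ∑ r : Fin P.d → Fin P.L,
          (((E (exitBond c r) : Matrix.specialUnitaryGroup (Fin 2) ℂ) : Matrix (Fin 2) (Fin 2) ℂ) - 1)‖ + 28 * t ^ 2 := by
  have hδ : 2 * t < deltaSU (Fin 2) := by linarith [one_tenth_lt_deltaSU_two]
  unfold MiddleBondRepair.mdist
  rw [norm_sub_rev]
  exact norm_avgFun_mulField_faceSec_sub_le hj hE ht ht' hδ V c

end Avg

/-! ## §2 (layer F3) Plaquettes of a corrected configuration to second order, first-order term isolated -/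

section Plaq

open scoped Matrix.Norms.L2Operator

variable {n : Type*} [Fintype n] [DecidableEq n] [Nonempty n]

/-- **PLAQUETTES OF `E · W` WITH THE FIRST-ORDER TERM ISOLATED** (`SU(N)`): if the four `E`-factors on `∂p` are within `t` of `1`, then with
`ρ = 6t² + 4t³ + t⁴` and `D = W(∂p) − 1`,
`dist1 ((E·W)(∂p)) ≤ ‖linCobd E W p + D‖ + ρ + (4t + 2ρ)·‖D‖` — the LINEAR TERM `linCobd + D` (for `E = exp ζ`, `W = faceSec V`:
`(d_W ζ)(p) + (V(∂p′) − 1)` on the edge plaquettes, `(d_W ζ)(p)` elsewhere) is what the certified row bounds of the linear lift control. -/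
theorem dist1_plaqHol_mulField_le_lin_add (E W : GaugeField P j (Matrix.specialUnitaryGroup n ℂ)) (p : Plaq P j) {t : ℝ}
    (h₁ : dist1 (E ⟨p.src, p.μ⟩) ≤ t) (h₂ : dist1 (E ⟨p.src.shift p.μ, p.ν⟩) ≤ t) (h₃ : dist1 (E ⟨p.src.shift p.ν, p.μ⟩) ≤ t)
    (h₄ : dist1 (E ⟨p.src, p.ν⟩) ≤ t) :
    dist1 (GaugeField.plaqHol (mulField E W) p) ≤
      ‖linCobd E W p + (((GaugeField.plaqHol W p : Matrix.specialUnitaryGroup n ℂ) : Matrix n n ℂ) - 1)‖ +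
        (6 * t ^ 2 + 4 * t ^ 3 + t ^ 4) +
        (4 * t + 2 * (6 * t ^ 2 + 4 * t ^ 3 + t ^ 4)) * dist1 (GaugeField.plaqHol W p) := by
  have t0 : 0 ≤ t := (GaugeGroup.dist1_nonneg _).trans h₁
  set ρ : ℝ := 6 * t ^ 2 + 4 * t ^ 3 + t ^ 4 with hρ
  have ρ0 : 0 ≤ ρ := by positivity
  set X : Matrix n n ℂ := ((twistedCobd E W p : Matrix.specialUnitaryGroup n ℂ) : Matrix n n ℂ) with hX
  set Q : Matrix n n ℂ := ((GaugeField.plaqHol W p : Matrix.specialUnitaryGroup n ℂ) : Matrix n n ℂ) with hQ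
  set lin : Matrix n n ℂ := linCobd E W p with hlin
  have hR : ‖X - 1 - lin‖ ≤ ρ := norm_twistedCobd_sub_one_sub_lin_le E W p h₁ h₂ h₃ h₄
  have hX1 : ‖X - 1‖ ≤ 4 * t := by
    have h := dist1_twistedCobd_le E W p
    have h' : dist1 (twistedCobd E W p) = ‖X - 1‖ := rfl
    rw [← h']; linarith
  have hlinle : ‖lin‖ ≤ 4 * t + ρ := by
    have : lin = (X - 1) - (X - 1 - lin) := by abel
    rw [this]
    exact (norm_sub_le _ _).trans (add_le_add hX1 hR)
  have hD : dist1 (GaugeField.plaqHol W p) = ‖Q - 1‖ := rfl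
  have hprod : dist1 (GaugeField.plaqHol (mulField E W) p) = ‖X * Q - 1‖ := by
    rw [plaqHol_mul_left]
    show ‖(((twistedCobd E W p * GaugeField.plaqHol W p : Matrix.specialUnitaryGroup n ℂ)) : Matrix n n ℂ) - 1‖ = _
    rw [Submonoid.coe_mul]
  rw [hprod, hD]
  have hsplit : X * Q - 1 = (lin + (Q - 1)) + (X - 1 - lin) * Q + lin * (Q - 1) := by noncomm_ring
  rw [hsplit]
  have hQn : ‖Q‖ ≤ 1 + ‖Q - 1‖ := by
    calc ‖Q‖ = ‖1 + (Q - 1)‖ := by rw [add_sub_cancel]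
      _ ≤ ‖(1 : Matrix n n ℂ)‖ + ‖Q - 1‖ := norm_add_le _ _
      _ ≤ 1 + ‖Q - 1‖ := by gcongr; exact norm_one.le
  calc ‖lin + (Q - 1) + (X - 1 - lin) * Q + lin * (Q - 1)‖
      ≤ ‖lin + (Q - 1)‖ + ‖(X - 1 - lin) * Q‖ + ‖lin * (Q - 1)‖ :=
        (norm_add_le _ _).trans (add_le_add (norm_add_le _ _) le_rfl)
    _ ≤ ‖lin + (Q - 1)‖ + ρ * (1 + ‖Q - 1‖) + (4 * t + ρ) * ‖Q - 1‖ := by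
        gcongr
        · exact (norm_mul_le _ _).trans (mul_le_mul hR hQn (norm_nonneg _) ρ0)
        · exact (norm_mul_le _ _).trans (mul_le_mul_of_nonneg_right hlinle (norm_nonneg _))
    _ = ‖lin + (Q - 1)‖ + ρ + (4 * t + 2 * ρ) * ‖Q - 1‖ := by ring

end Plaq

end Summit.QuantumFields.YangMills.Theorems.ApproxLift

end
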